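import Mathlib
import Summits.ValiantsHypothesis.ValiantsHypothesis.Theses.FermionizationDimension
import Literature.Computability.AlgebraicComplexity.ValiantClassesProofs
import Literature.Computability.AlgebraicComplexity.ValiantConjectureEquivProofs
import Summits.ValiantsHypothesis.ValiantsHypothesis.Theorems.DetqpThesis.Negative.Variants
import Summits.ValiantsHypothesis.ValiantsHypothesis.Theorems.ClassTransfer.Negative.BlockSums
import Summits.ValiantsHypothesis.ValiantsHypothesis.Theorems.ClassTransfer.Negative.CyclicBlockSums
import Summits.ValiantsHypothesis.ValiantsHypothesis.Theorems.ClassTransfer.Negative.EvenCycleDetPerHard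

/-!
# Crux `ClassTransfer` (stmt-ValiantsHypothesis-7287), negative side — the COVER-BALANCE TESTS:
# every class-function family with an unbalanced 2-fold or 3-fold cover average is permanent-hard

Lead prover (gen 1) of line `registered`.  The gen-0 lead showed that the three falsifier
families recorded for the crux (`sgn · 4^{c₂}`, the 2-cycle-free determinant `D₂`, the even-cycle
determinant `D^even`) are permanent-hard, each by a bespoke block substitution
(`Negative/FalsifierPerHard.lean`, `Negative/EvenCycleDetPerHard.lean`).  This file proves the
mechanism once and for all, for an ARBITRARY class function, so that the crux's disprover and
ideation can test any candidate family mechanically: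

* `isProjection_perPoly_classGMF_two` — **two-fold cover test.**  For every class function
  `w` on `S_{m+m}` (`m ≥ 1`): if the balance constant `K₂(w) = Σ_{δ ∈ S_m} w(2·δ)` is nonzero,
  where `2·δ` is the block map `inl i ↦ inr i, inr j ↦ inl (δ j)` (cycle type = that of `δ`
  with every length doubled), then `per_m` is a projection of `d_w = Σ_σ w(σ) x^σ`: substitute
  `[[0, κJ], [X, 0]]`; only block maps `(α, β)` survive (`sum_perm_blockAntidiag`), each is
  CONJUGATE to `2·(βα)` (`isConj_blockAntidiag`), so the weight is `w(2·(βα))` and summing over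
  `β` leaves `κ^m K₂(w) · per_m(X)`.
* `isProjection_perPoly_classGMF_three` — **three-fold cover test.**  Same on `S_{3m}` with the
  cyclic substitution `L → M → R → L` (blocks `X`, `κJ`, `κJ`), the block maps
  `(k, i) ↦ (k+1, α_k i)` being conjugate to `3·(α₂α₁α₀)` (`isConj_blockCyclic_three`); the
  constant is `K₃(w) = Σ_{δ ∈ S_m} w(3·δ)` (times `m!`).
* family level: `isPProjection_perPoly_classGMF_two/three`,
  `VP_eq_VNP_of_isVPFamily_classGMF_two/three` — **a class-function family `χ` whose GMF family
  is in `VP` and whose balance constants `K₂(χ_{2m})` (resp. `K₃(χ_{3m})`) are nonzero for all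
  `m ≥ 1` forces `VP = VNP`.**  Contrapositively, under `ValiantsHypothesis` every `VP`
  class-function family is 2- and 3-BALANCED for all large `m` (up to the sparse exceptions a
  p-projection tolerates) — a linear test on `χ` that every candidate falsifier of the crux must
  pass before its twisting dimension is even worth bounding.
* `VP_eq_VNP_of_isVPFamily_oddOrderCover` — a new instance for the record: the ODD-CYCLE cover
  polynomial `Σ_{σ of odd order} x^σ` (= `Σ_{all cycles odd} sgn(σ) x^σ`, since such `σ` are
  even) is permanent-hard (`K₃ = #{δ ∈ S_m of odd order} ≥ 1`), complementing `D^even`.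

The two tests are independent: `D^even` is 2-balanced (`K₂ = ± Σ_δ sgn δ = 0`) but not
3-balanced, `sgn · t^{c₂}` is 3-balanced (`3·δ` has no 2-cycles, `K₃ = Σ_δ sgn δ · 1 = 0`) but not
2-balanced.  No definitions (block maps inlined as in `BlockSums.lean` / `CyclicBlockSums.lean`).
References: block substitutions are folklore (Valiant 1979 style projections; Bürgisser 2000
§2.1 for p-projections). [folklore]
-/

set_option linter.dupNamespace false

noncomputable section

namespace Summit.ValiantsHypothesis.ValiantsHypothesis.Theorems.ClassTransfer.Negative

open Equiv Finset

/-! ## Conjugacy normal forms of block maps -/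

/-- Conjugation transported along a relabelling of the points. [folklore] -/
theorem isConj_permCongr {α β : Type*} (e : α ≃ β) {σ τ : Perm α} (h : IsConj σ τ) :
    IsConj (e.permCongr σ) (e.permCongr τ) := by
  have h' := MonoidHom.map_isConj e.permCongrHom.toMonoidHom h
  simpa [Equiv.permCongrHom_coe] using h'

/-- **Two-block maps are classified up to conjugacy by the composite.**  The block map
`inl i ↦ inr (α i), inr j ↦ inl (β j)` is conjugate (by `inl i ↦ inl i, inr j ↦ inr (α j)`) to
the normal form `inl i ↦ inr i, inr j ↦ inl (βα j)`. [folklore] -/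
theorem isConj_blockAntidiag {ι : Type*} (α β : Perm ι) :
    IsConj ((Equiv.sumCongr (1 : Perm ι) (β * α)).trans (Equiv.sumComm ι ι))
      ((Equiv.sumCongr α β).trans (Equiv.sumComm ι ι)) := by
  refine isConj_iff.2 ⟨Equiv.sumCongr (1 : Perm ι) α, ?_⟩
  rw [mul_inv_eq_iff_eq_mul]
  refine Equiv.ext fun x => ?_
  rcases x with i | j <;> simp [Perm.mul_apply]

/-- **Three-block cyclic maps are classified up to conjugacy by the composite.**  The cyclic
block map `(k, i) ↦ (k+1, α_k i)` is conjugate (by the block-diagonal map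
`(0, i) ↦ (0, i), (1, i) ↦ (1, α₀ i), (2, i) ↦ (2, α₁α₀ i)`) to the normal form with block maps
`(1, 1, α₂α₁α₀)`. [folklore] -/
theorem isConj_blockCyclic_three {ι : Type*} (α : Fin 3 → Perm ι) :
    IsConj ((Equiv.prodCongrRight ![(1 : Perm ι), 1, α 2 * α 1 * α 0]).trans
        (Equiv.prodCongrLeft fun _ : ι => Equiv.addRight (1 : Fin 3)))
      ((Equiv.prodCongrRight α).trans (Equiv.prodCongrLeft fun _ : ι => Equiv.addRight (1 : Fin 3))) := by
  refine isConj_iff.2 ⟨Equiv.prodCongrRight ![(1 : Perm ι), α 0, α 1 * α 0], ?_⟩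
  rw [mul_inv_eq_iff_eq_mul]
  refine Equiv.ext fun x => ?_
  obtain ⟨k, i⟩ := x
  fin_cases k <;> simp [Perm.mul_apply]

/-! ## Two-fold cover test -/

/-- **Two-fold cover test.**  For a class function `w` on `S_{m+m}` with nonzero balance
constant `K₂(w) = Σ_δ w(inl i ↦ inr i, inr j ↦ inl (δ j))`, the permanent `per_m` is a
projection of `Σ_σ w(σ) x^σ` (substitute `[[0, κJ], [X, 0]]`, `κ^m = K₂(w)⁻¹`). [folklore] -/
theorem isProjection_perPoly_classGMF_two (m : ℕ) (hm : 0 < m)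
    (w : Perm (Fin (m + m)) → ℂ) (hw : ∀ σ τ : Perm (Fin (m + m)), IsConj σ τ → w σ = w τ)
    (hK : ∑ δ : Perm (Fin m), w (finSumFinEquiv.permCongr
      ((Equiv.sumCongr (1 : Perm (Fin m)) δ).trans (Equiv.sumComm (Fin m) (Fin m)))) ≠ 0) :
    Literature.Computability.AlgebraicComplexity.IsProjection
      (Literature.Computability.AlgebraicComplexity.perPoly (Fin m) ℂ)
      (∑ σ : Equiv.Perm (Fin (m + m)),
        MvPolynomial.C (w σ) * ∏ i : Fin (m + m), MvPolynomial.X (σ i, i)) := by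
  classical
  set e : Fin m ⊕ Fin m ≃ Fin (m + m) := finSumFinEquiv with he
  set K : ℂ := ∑ δ : Perm (Fin m), w (e.permCongr
      ((Equiv.sumCongr (1 : Perm (Fin m)) δ).trans (Equiv.sumComm (Fin m) (Fin m)))) with hKdef
  obtain ⟨κ, hκ⟩ : ∃ κ : ℂ, κ ^ m = K⁻¹ := IsAlgClosed.exists_pow_nat_eq _ hm
  -- the substitution `[[0, κ J], [X, 0]]` in block coordinates
  set E' : (Fin m ⊕ Fin m) → (Fin m ⊕ Fin m) → MvPolynomial (Fin m × Fin m) ℂ := fun r c =>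
    Sum.elim (fun _ => Sum.elim (fun _ => (0 : MvPolynomial (Fin m × Fin m) ℂ))
        (fun _ => MvPolynomial.C κ) c)
      (fun r' => Sum.elim (fun c' => MvPolynomial.X (r', c')) (fun _ => 0) c) r with hE'
  have hLL : ∀ i j, E' (Sum.inl i) (Sum.inl j) = 0 := fun _ _ => rfl
  have hRR : ∀ i j, E' (Sum.inr i) (Sum.inr j) = 0 := fun _ _ => rfl
  have hRL : ∀ i j, E' (Sum.inr i) (Sum.inl j) = MvPolynomial.X (i, j) := fun _ _ => rfl
  have hLR : ∀ i j, E' (Sum.inl i) (Sum.inr j) = MvPolynomial.C κ := fun _ _ => rfl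
  set a : Fin (m + m) × Fin (m + m) → MvPolynomial (Fin m × Fin m) ℂ :=
    fun rc => E' (e.symm rc.1) (e.symm rc.2) with ha
  refine ⟨a, ?_, ?_⟩
  · rintro ⟨r, c⟩
    simp only [ha]
    generalize e.symm r = u
    generalize e.symm c = v
    rcases u with r' | r' <;> rcases v with c' | c'
    · exact Or.inr ⟨0, by rw [hLL, map_zero]⟩
    · exact Or.inr ⟨κ, hLR r' c'⟩
    · exact Or.inl ⟨(r', c'), hRL r' c'⟩
    · exact Or.inr ⟨0, by rw [hRR, map_zero]⟩
  · symm
    rw [map_sum]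
    have hterm : ∀ σ : Perm (Fin (m + m)),
        MvPolynomial.aeval a (MvPolynomial.C (w σ) *
          ∏ i : Fin (m + m), MvPolynomial.X (σ i, i)) =
        MvPolynomial.C (w σ) * ∏ i : Fin (m + m), a (σ i, i) := by
      intro σ
      rw [map_mul, map_prod, MvPolynomial.aeval_C, MvPolynomial.algebraMap_eq]
      simp only [MvPolynomial.aeval_X]
    rw [Finset.sum_congr rfl fun σ _ => hterm σ]
    -- transport the permutation sum to `Fin m ⊕ Fin m`
    rw [← Fintype.sum_equiv e.permCongr
      (fun σ' => MvPolynomial.C (w (e.permCongr σ')) * ∏ y : Fin m ⊕ Fin m, E' (σ' y) y) _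
      (fun σ' => ?_)]
    swap
    · congr 1
      rw [← Fintype.prod_equiv e (fun y => a ((e.permCongr σ') (e y), e y)) _ (fun _ => rfl)]
      refine Fintype.prod_congr _ _ fun y => ?_
      simp [ha, Equiv.permCongr_apply]
    -- only block maps survive
    rw [sum_perm_blockAntidiag _ E' hLL hRR]
    simp only [hRL, hLR, Finset.prod_const, Finset.card_univ, Fintype.card_fin]
    -- the weight of a block map only depends on the composite (conjugacy normal form)
    have hwL : ∀ p : Perm (Fin m) × Perm (Fin m),
        w (e.permCongr ((Equiv.sumCongr p.1 p.2).trans (Equiv.sumComm (Fin m) (Fin m)))) =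
          w (e.permCongr ((Equiv.sumCongr (1 : Perm (Fin m)) (p.2 * p.1)).trans
            (Equiv.sumComm (Fin m) (Fin m)))) :=
      fun p => (hw _ _ (isConj_permCongr e (isConj_blockAntidiag p.1 p.2))).symm
    rw [Finset.sum_congr rfl fun p _ => by rw [hwL p]]
    -- sum over `β` first, reindexing `β ↦ β α`
    rw [Fintype.sum_prod_type]
    have hα : ∀ α : Perm (Fin m),
        ∑ β : Perm (Fin m), MvPolynomial.C (w (e.permCongr
            ((Equiv.sumCongr (1 : Perm (Fin m)) (β * α)).trans (Equiv.sumComm (Fin m) (Fin m))))) *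
            ((∏ i : Fin m, MvPolynomial.X (α i, i)) * MvPolynomial.C κ ^ m) =
          ∏ i : Fin m, (MvPolynomial.X (α i, i) : MvPolynomial (Fin m × Fin m) ℂ) := by
      intro α
      rw [← Finset.sum_mul, ← map_sum,
        Fintype.sum_equiv (Equiv.mulRight α)
          (fun β => w (e.permCongr ((Equiv.sumCongr (1 : Perm (Fin m)) (β * α)).trans
            (Equiv.sumComm (Fin m) (Fin m)))))
          (fun δ => w (e.permCongr ((Equiv.sumCongr (1 : Perm (Fin m)) δ).trans
            (Equiv.sumComm (Fin m) (Fin m)))))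
          (fun β => rfl),
        ← hKdef, ← map_pow, hκ]
      rw [mul_comm, mul_assoc, ← map_mul, inv_mul_cancel₀ hK, map_one, mul_one]
    rw [Finset.sum_congr rfl fun α _ => hα α]
    simp [Literature.Computability.AlgebraicComplexity.perPoly, Matrix.permanent,
      Matrix.mvPolynomialX]

/-! ## Three-fold cover test -/

/-- **Three-fold cover test.**  For a class function `w` on `S_{3m}` with nonzero balance
constant `K₃(w) = Σ_δ w((k, i) ↦ (k+1, (1, 1, δ)_k i))`, the permanent `per_m` is a projection of
`Σ_σ w(σ) x^σ`: substitute the block-cyclic matrix with blocks `X`, `κJ`, `κJ`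
(`κ^{2m} = (m! K₃(w))⁻¹`); only cyclic block maps survive (`sum_perm_blockCyclic`), each
conjugate to the normal form of its composite (`isConj_blockCyclic_three`), and re-coordinatising
by (first map, second map, composite) (`sum_fin_three_perm_eq`) collapses the sum to
`κ^{2m} m! K₃(w) · per_m(X)`. [folklore] -/
theorem isProjection_perPoly_classGMF_three (m : ℕ) (hm : 0 < m)
    (w : Perm (Fin (3 * m)) → ℂ) (hw : ∀ σ τ : Perm (Fin (3 * m)), IsConj σ τ → w σ = w τ)
    (hK : ∑ δ : Perm (Fin m), w (finProdFinEquiv.permCongr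
      ((Equiv.prodCongrRight ![(1 : Perm (Fin m)), 1, δ]).trans
        (Equiv.prodCongrLeft fun _ : Fin m => Equiv.addRight (1 : Fin 3)))) ≠ 0) :
    Literature.Computability.AlgebraicComplexity.IsProjection
      (Literature.Computability.AlgebraicComplexity.perPoly (Fin m) ℂ)
      (∑ σ : Equiv.Perm (Fin (3 * m)),
        MvPolynomial.C (w σ) * ∏ i : Fin (3 * m), MvPolynomial.X (σ i, i)) := by
  classical
  set e : Fin 3 × Fin m ≃ Fin (3 * m) := finProdFinEquiv with he
  set K : ℂ := ∑ δ : Perm (Fin m), w (e.permCongr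
      ((Equiv.prodCongrRight ![(1 : Perm (Fin m)), 1, δ]).trans
        (Equiv.prodCongrLeft fun _ : Fin m => Equiv.addRight (1 : Fin 3)))) with hKdef
  have hfact : ((Nat.factorial m : ℕ) : ℂ) ≠ 0 := Nat.cast_ne_zero.2 (Nat.factorial_ne_zero m)
  obtain ⟨κ, hκ⟩ : ∃ κ : ℂ, κ ^ (2 * m) = (((Nat.factorial m : ℕ) : ℂ) * K)⁻¹ :=
    IsAlgClosed.exists_pow_nat_eq _ (by omega)
  -- the substitution, in block coordinates
  set E' : (Fin 3 × Fin m) → (Fin 3 × Fin m) → MvPolynomial (Fin m × Fin m) ℂ := fun r c =>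
    if r.1 = c.1 + 1 then (if c.1 = 0 then MvPolynomial.X (r.2, c.2) else MvPolynomial.C κ) else 0
    with hE'
  have hEoff : ∀ (k k' : Fin 3) (i i' : Fin m), k' ≠ k + 1 → E' (k', i') (k, i) = 0 := by
    intro k k' i i' hk; simp [hE', hk]
  have hEon : ∀ (k : Fin 3) (i i' : Fin m), E' (k + 1, i') (k, i) =
      if k = 0 then MvPolynomial.X (i', i) else MvPolynomial.C κ := by
    intro k i i'; simp [hE']
  set a : Fin (3 * m) × Fin (3 * m) → MvPolynomial (Fin m × Fin m) ℂ :=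
    fun rc => E' (e.symm rc.1) (e.symm rc.2) with ha
  refine ⟨a, ?_, ?_⟩
  · rintro ⟨r, c⟩
    simp only [ha, hE']
    split_ifs
    · exact Or.inl ⟨_, rfl⟩
    · exact Or.inr ⟨κ, rfl⟩
    · exact Or.inr ⟨0, by rw [map_zero]⟩
  · symm
    rw [map_sum]
    have hterm : ∀ σ : Perm (Fin (3 * m)),
        MvPolynomial.aeval a (MvPolynomial.C (w σ) *
          ∏ i : Fin (3 * m), MvPolynomial.X (σ i, i)) =
        MvPolynomial.C (w σ) * ∏ i : Fin (3 * m), a (σ i, i) := by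
      intro σ
      rw [map_mul, map_prod, MvPolynomial.aeval_C, MvPolynomial.algebraMap_eq]
      simp only [MvPolynomial.aeval_X]
    rw [Finset.sum_congr rfl fun σ _ => hterm σ]
    -- transport to block coordinates
    rw [← Fintype.sum_equiv e.permCongr
      (fun σ' => MvPolynomial.C (w (e.permCongr σ')) * ∏ y : Fin 3 × Fin m, E' (σ' y) y) _
      (fun σ' => ?_)]
    swap
    · congr 1
      rw [← Fintype.prod_equiv e (fun y => a ((e.permCongr σ') (e y), e y)) _ (fun _ => rfl)]
      refine Fintype.prod_congr _ _ fun y => ?_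
      simp [ha, Equiv.permCongr_apply]
    -- only cyclic block maps survive
    rw [sum_perm_blockCyclic _ E' hEoff]
    -- evaluate each surviving term: entries, and the weight via the conjugacy normal form
    have hval : ∀ α : Fin 3 → Perm (Fin m),
        MvPolynomial.C (w (e.permCongr ((Equiv.prodCongrRight α).trans
            (Equiv.prodCongrLeft fun _ : Fin m => Equiv.addRight (1 : Fin 3))))) *
          ∏ k : Fin 3, ∏ i : Fin m, E' (k + 1, α k i) (k, i) =
        (MvPolynomial.C (κ ^ (2 * m)) * ∏ i : Fin m, MvPolynomial.X (α 0 i, i)) *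
          MvPolynomial.C (w (e.permCongr ((Equiv.prodCongrRight
            ![(1 : Perm (Fin m)), 1, α 2 * α 1 * α 0]).trans
              (Equiv.prodCongrLeft fun _ : Fin m => Equiv.addRight (1 : Fin 3))))) := by
      intro α
      rw [hw _ _ (isConj_permCongr e (isConj_blockCyclic_three α)).symm]
      simp only [hEon, Fin.prod_univ_three]
      have h1 : ((1 : Fin 3) = 0) = False := by decide
      have h2 : ((2 : Fin 3) = 0) = False := by decide
      simp only [if_true, h1, h2, if_false, Finset.prod_const, Finset.card_univ,
        Fintype.card_fin]
      rw [map_pow]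
      ring
    rw [Finset.sum_congr rfl fun α _ => hval α]
    -- regroup: `α ↦ (α 0, α 1, α 2 α 1 α 0)`
    rw [sum_fin_three_perm_eq (fun a δ => (MvPolynomial.C (κ ^ (2 * m)) *
        ∏ i : Fin m, MvPolynomial.X (a i, i)) * MvPolynomial.C (w (e.permCongr
          ((Equiv.prodCongrRight ![(1 : Perm (Fin m)), 1, δ]).trans
            (Equiv.prodCongrLeft fun _ : Fin m => Equiv.addRight (1 : Fin 3))))))]
    have hα : ∀ a : Perm (Fin m),
        ∑ _b : Perm (Fin m), ∑ δ : Perm (Fin m), (MvPolynomial.C (κ ^ (2 * m)) *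
          ∏ i : Fin m, MvPolynomial.X (a i, i)) * MvPolynomial.C (w (e.permCongr
            ((Equiv.prodCongrRight ![(1 : Perm (Fin m)), 1, δ]).trans
              (Equiv.prodCongrLeft fun _ : Fin m => Equiv.addRight (1 : Fin 3))))) =
          ∏ i : Fin m, (MvPolynomial.X (a i, i) : MvPolynomial (Fin m × Fin m) ℂ) := by
      intro a
      rw [Finset.sum_const, Finset.card_univ, Fintype.card_perm, Fintype.card_fin,
        ← Finset.mul_sum, ← map_sum, ← hKdef, nsmul_eq_mul, ← MvPolynomial.C_eq_coe_nat]
      have hone : ((Nat.factorial m : ℕ) : ℂ) * (κ ^ (2 * m) * K) = 1 := by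
        rw [hκ]
        field_simp
      rw [mul_comm (MvPolynomial.C (κ ^ (2 * m))) _, mul_assoc, ← map_mul, ← mul_assoc,
        mul_comm (MvPolynomial.C ((Nat.factorial m : ℕ) : ℂ)) _, mul_assoc, ← map_mul, hone,
        map_one, mul_one]
    rw [Finset.sum_congr rfl fun a _ => hα a]
    simp [Literature.Computability.AlgebraicComplexity.perPoly, Matrix.permanent,
      Matrix.mvPolynomialX]

end Summit.ValiantsHypothesis.ValiantsHypothesis.Theorems.ClassTransfer.Negative
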